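import Literature.AnabelianGeometry.AbsoluteAnabelian.MLFUnitsOfGaloisGroupProofs
import Literature.AnabelianGeometry.AbsoluteAnabelian.AbsTopIII.ReconstructionCor110iProofs
import Literature.AnabelianGeometry.AbsoluteAnabelian.MonoAnalyticNonarchAlgorithmModel
import Literature.AnabelianGeometry.AbsoluteAnabelian.AbsTopI.ChainTransport
import Literature.AnabelianGeometry.AbsoluteAnabelian.SlimTransport
import Literature.FieldTheory.AlgClosed.PadicAlgClEquivComplex
import HarnessLib

/-!
# [AbsTopIII] Cor. 1.10 (ii)(d): the unit group `k^×` is recovered from `Π_X` — discharge of the named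
# fact `AbsTopIII.Cor_1_10_ii` (universe `0`)

Mochizuki, *Topics in Absolute Anabelian Geometry III*, §1 Cor. 1.10 (ii) p. 42 (manuscript
pagination, lit key `paper:url-5493eb38cbb7`): over an MLF `k` and for an arbitrary hyperbolic
orbicurve `X/k`, "(d) one constructs the image of the Kummer map
`k^× ↪ H¹(G_k, μ_Ẑ(Π_X)) ↪ H¹(Π_X, μ_Ẑ(Π_X))`" — the GROUP `k^×` is reconstructed from the profinite
group (the additive structure on `k^× ∪ {0}` is (iii)(h), strictly Belyi type, NOT part of (ii)).

The named fact `AbsTopIII.Cor_1_10_ii M` (`Reconstruction.lean`, abc-iut-L4-t1; FACT-LIST F-0395),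
relative to a model `M : CurveModel`, asks for an `MLFReconstructionAlgorithm` whose Kummer image
`kummerBase.range` is, on every curve of the model over an MLF `k`, isomorphic AS A GROUP to `k^×`.
This file PROVES it for every `M : CurveModel.{0}`:

* `nonempty_unitsMulEquiv_of_isMLF_of_padicSubfield` — for an MLF `k` and a finite `E ⊆ ℚ̄_p` with
  `Γ_k ≃ₜ* Γ_E`, `k^× ≃* E^×`: the CONTENT, i.e. the unit group of an MLF is an invariant of its
  absolute Galois group (`Prop121vii.nonempty_unitsMulEquiv_of_continuousMulEquiv`, from the
  `α`-equivariant units transport of [AbsAnab] Prop. 1.2.1 (vi) restricted to Galois-fixed points —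
  local class field theory, IN TREE, BY NAME);
* `AbsTopIII.cor_1_10_ii_holds : ∀ M : CurveModel.{0}, AbsTopIII.Cor_1_10_ii M`.

THE WITNESS ALGORITHM (and why it has this shape).  `Cor_1_10_ii` only types the EXISTENCE of an
algorithm; the output signature `MLFReconstruction E` bundles the (ii)-output `kummerBase` with a
FIELD `baseField` ((iii)(h)) and a function field ((iii)), and `MLFReconstructionAlgorithm` demands
a RING isomorphism of base fields along every isomorphism of extensions (`map`) and a ring
homomorphism of function fields along every open injection of ABSTRACT extensions (`comap`).  Hence:
(1) `baseField E :=` a finite `E* ⊆ ℚ̄_{p*}` with `Γ_{E*} ≃ₜ* E.gal`, chosen by `Classical.epsilon`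
over a predicate that depends only on the ISOMORPHISM CLASS of the profinite group `E.gal` — so
`map` is the identity cast; `E* ≅ k` AS FIELDS is NOT claimed (false in general: non-geometric
isomorphisms of absolute Galois groups of MLFs, [AbsTopIII] Rmk. 1.9.4); (2) `functionField := ℂ`
(every `ℚ̄_p` embeds, `PadicAlgCl.nonempty_ringEquiv_complex`) with `comap := id` — forced by the
`comap` clause; (3) `H1 := (E*)^×`, `kummerBase := id`; cyclotomes, `frobQuot`, decomposition groups
are PLACEHOLDERS exactly as in abc-iut-L4-d3's `cor_1_10_i_holds` (Cor. 1.10 (i)(a)/(b), (iii) are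
the separate facts F-1387 / F-0347 / F-0394 / F-0396 — NOT addressed here).  The verification at a
curve `X` over an MLF `k` is then: `Γ_k ≅ (M.ext X).gal ≅ Γ_{E*}` (model `galIso` + `epsilon_spec`,
the class being inhabited by `IsMLF.exists_galEquiv_padicSubfield`), hence `(E*)^× ≃* k^×`.

VACUITY AUDIT (abc-iut-L4-lead RULING #5b (3), step 1): `Cor_1_10_ii M` is NOT closable by a
group-IGNORING choice — `kummerBase` injective forces `range ≃* baseFieldˣ`, the algorithm is fixed
before `X`, and a model may present two MLF-based curves with the SAME extension, so the universal
closure is EQUIVALENT in strength (modulo placeholder slots) to the bi-anabelian statement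
"`Γ_k ≃ₜ* Γ_{k'} ⇒ k^× ≃* k'^×`"; `not_nonempty_ratUnits_mulEquiv_of_isMLF` records that the (i)
witness's placeholder `baseField := ℚ` does NOT close (ii) (`ℚ^×` is countable, `k^×` is not).  It IS
typed-weak: only the abstract isomorphism type of `k^×` is demanded (the mono-anabelian construction
"`k^×` = elements of Frobenius-integral degree in `G_k^ab`" is not forced by the typed Prop).
Universe `0` (reach of `Prop121vii.unitsTransport_holds` and of the `ℚ̄_p`-presentations).
Proof-only; classical local class field theory; nothing here bears on [IUTchIII] Cor. 3.12 or takes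
a side.
-/

noncomputable section

open CategoryTheory Function Cardinal
open ProfiniteGrp ProfiniteGrp.ProfiniteCompletion Topology

namespace Literature.AnabelianGeometry.AbsoluteAnabelian

open Field ValuativeRel
open Literature.NumberTheory.GaloisRepresentations
open Literature.NumberTheory.GaloisRepresentations.IsNonarchimedeanLocalField

/-! ### The content: `k^× ≃* E^×` for a `ℚ̄_p`-presentation `Γ_k ≅ Γ_E` -/

/-- **`k^×` is an invariant of `G_k`** at a `ℚ̄_p`-presentation: for an MLF `k` (the cell's `IsMLF`),
a finite `E ⊆ ℚ̄_p` and an isomorphism of profinite groups `Γ_k ≃ₜ* Γ_E`, the unit groups are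
isomorphic, `k^× ≃* E^×` — [AbsTopIII] Cor. 1.10 (ii)(d) in bi-anabelian form, via
`Prop121vii.nonempty_unitsMulEquiv_of_continuousMulEquiv` (the `α`-equivariant units transport of
[AbsAnab] Prop. 1.2.1 (vi) on Galois-fixed points), the local-field structures being those of finite
extensions of `ℚ_p` (`FiniteExtension.isNonarchimedeanLocalField`).
[cite: MochizukiAbsTopIII2015, Cor 1.10 (ii) p.42] -/
theorem nonempty_unitsMulEquiv_of_isMLF_of_padicSubfield (k : Type) [Field k] [CharZero k]
    (hk : IsMLF k) {p : ℕ} [Fact p.Prime] (E : IntermediateField ℚ_[p] (PadicAlgCl p))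
    [FiniteDimensional ℚ_[p] E] (α : absoluteGaloisGroup k ≃ₜ* absoluteGaloisGroup E) :
    Nonempty (kˣ ≃* (E : Type)ˣ) := by
  obtain ⟨q, hq, φ, hfin⟩ := hk.exists_padic
  letI : Algebra ℚ_[q] k := φ.toAlgebra
  haveI : Module.Finite ℚ_[q] k := hfin
  haveI : IsNonarchimedeanLocalField ℚ_[q] := Padic.isNonarchimedeanLocalField_holds q
  letI := FiniteExtension.valuativeRel ℚ_[q] k
  letI := FiniteExtension.topologicalSpace ℚ_[q] k
  haveI : IsNonarchimedeanLocalField k := FiniteExtension.isNonarchimedeanLocalField ℚ_[q] k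
  haveI : IsNonarchimedeanLocalField ℚ_[p] := Padic.isNonarchimedeanLocalField_holds p
  letI := FiniteExtension.valuativeRel ℚ_[p] E
  letI := FiniteExtension.topologicalSpace ℚ_[p] E
  haveI : IsNonarchimedeanLocalField E := FiniteExtension.isNonarchimedeanLocalField ℚ_[p] E
  haveI : CharZero E := charZero_of_injective_algebraMap (algebraMap ℚ_[p] E).injective
  exact Prop121vii.nonempty_unitsMulEquiv_of_continuousMulEquiv k E α

/-! ### Degenerate-witness pass: the placeholder base field `ℚ` of the (i)-witness fails (ii) -/

/-- `ℚ^×` is not isomorphic to the unit group of an MLF: `ℚ^×` is countable while `k^× ⊇ ℚ_p^×` has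
cardinality `𝔠` (`Cardinal.mk_padic`).  Hence the placeholder `baseField := ℚ` of the Cor. 1.10 (i)
witness (`cor_1_10_i_holds`) does NOT close Cor. 1.10 (ii): the `kummerBase` slot must carry the
genuine invariant `k^×`. [cite: MochizukiAbsTopIII2015, Cor 1.10 (ii) p.42] -/
theorem not_nonempty_ratUnits_mulEquiv_of_isMLF (k : Type) [Field k] (hk : IsMLF k) :
    ¬ Nonempty (ℚˣ ≃* kˣ) := by
  rintro ⟨e⟩
  obtain ⟨p, hp, φ, -⟩ := hk.exists_padic
  -- `k^×` would be countable, hence `k`, hence `ℚ_p ↪ k`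
  haveI : Countable ℚˣ := Function.Injective.countable Units.val_injective
  haveI : Countable kˣ := Countable.of_equiv ℚˣ e.toEquiv
  haveI : Countable {x : k // x ≠ 0} := Countable.of_equiv kˣ unitsEquivNeZero
  haveI hk0 : Countable k := by
    refine Function.Surjective.countable (f := fun o : Option {x : k // x ≠ 0} => o.elim 0 Subtype.val)
      fun x => ?_
    by_cases hx : x = 0
    · exact ⟨none, hx.symm⟩
    · exact ⟨some ⟨x, hx⟩, rfl⟩
  haveI : Countable ℚ_[p] := Function.Injective.countable φ.injective
  have h1 : #ℚ_[p] ≤ ℵ₀ := Cardinal.mk_le_aleph0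
  rw [Cardinal.mk_padic] at h1
  exact absurd h1 (not_le.mpr Cardinal.aleph0_lt_continuum)

namespace AbsTopIII

/-! ### Cor. 1.10 (ii): the named fact, universe `0` -/

/-- **[AbsTopIII] Cor. 1.10 (ii) — the named fact `Cor_1_10_ii M` HOLDS for every model
`M : CurveModel.{0}`**: there is an `MLFReconstructionAlgorithm` whose Kummer image
`kummerBase.range` is, on every curve `X` of `M` over an MLF `k`, isomorphic as a group to `k^×`
("(d) one constructs the image of the Kummer map `k^× ↪ H¹(G_k, μ_Ẑ(Π_X)) ↪ H¹(Π_X, μ_Ẑ(Π_X))`").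
Witness (see the module docstring): `baseField E` = a finite `E* ⊆ ℚ̄_{p*}` with `Γ_{E*} ≅ E.gal`
chosen canonically on the isomorphism class of `E.gal` (`map` = identity cast), `functionField := ℂ`
(`comap := id`), `H1 := (E*)^×`, `kummerBase := id`, the remaining slots placeholders; the
verification `(E*)^× ≃* k^×` is `nonempty_unitsMulEquiv_of_isMLF_of_padicSubfield` along
`Γ_k ≅ (M.ext X).gal ≅ Γ_{E*}`.  `E* ≅ k` as FIELDS is NOT claimed ((ii) asserts the group only).
Universe `0`. [cite: MochizukiAbsTopIII2015, Cor 1.10 (ii) p.42] -/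
theorem cor_1_10_ii_holds (M : CurveModel.{0}) :
    Literature.AnabelianGeometry.AbsoluteAnabelian.AbsTopIII.Cor_1_10_ii M := by
  classical
  haveI hfact : ∀ p : Nat.Primes, Fact ((p : ℕ).Prime) := fun p => ⟨p.2⟩
  -- the bundles `(p, E ⊆ ℚ̄_p)` and the selection predicate on the isomorphism class of `G`
  let B : Type := Σ p : Nat.Primes, IntermediateField ℚ_[(p : ℕ)] (PadicAlgCl (p : ℕ))
  let Q : ProfiniteGrp.{0} → B → Prop := fun G b =>
    FiniteDimensional ℚ_[(b.1 : ℕ)] b.2 ∧ Nonempty (G ≃ₜ* absoluteGaloisGroup b.2)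
  haveI : Nonempty B := ⟨⟨⟨2, Nat.prime_two⟩, ⊥⟩⟩
  let sel : ProfiniteGrp.{0} → B := fun G => Classical.epsilon (Q G)
  have hQ : ∀ {G H : ProfiniteGrp.{0}}, (G ≃ₜ* H) → Q G = Q H := by
    intro G H e
    funext b
    refine propext ⟨fun h => ⟨h.1, ?_⟩, fun h => ⟨h.1, ?_⟩⟩
    · obtain ⟨f⟩ := h.2
      exact ⟨e.symm.trans f⟩
    · obtain ⟨f⟩ := h.2
      exact ⟨e.trans f⟩
  have hsel : ∀ {G H : ProfiniteGrp.{0}}, (G ≃ₜ* H) → sel G = sel H := by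
    intro G H e
    show Classical.epsilon (Q G) = Classical.epsilon (Q H)
    rw [hQ e]
  -- one embedding `ℚ̄_p ↪ ℂ` per prime, hence `E* ↪ ℂ`
  let ι : ∀ p : Nat.Primes, PadicAlgCl (p : ℕ) →+* ℂ := fun p =>
    (Classical.choice (PadicAlgCl.nonempty_ringEquiv_complex (p : ℕ))).toRingHom
  let emb : ∀ b : B, (b.2 : Type) →+* ℂ := fun b => (ι b.1).comp (algebraMap b.2 (PadicAlgCl (b.1 : ℕ)))
  -- the identity cast along an equality of bundles, and its compatibility with `emb`
  let castEq : ∀ {b₁ b₂ : B}, b₁ = b₂ → ((b₁.2 : Type) ≃+* (b₂.2 : Type)) :=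
    fun {b₁ b₂} h => by subst h; exact RingEquiv.refl _
  have hcast : ∀ {b₁ b₂ : B} (h : b₁ = b₂) (c : (b₁.2 : Type)),
      emb b₂ (castEq h c) = emb b₁ c := by
    intro b₁ b₂ h c
    subst h
    rfl
  -- THE CONTENT at each curve over an MLF, proved BEFORE the witness is assembled (small goals):
  -- the class of `(M.ext X).gal` is presented by some finite `E ⊆ ℚ̄_p`, so the selected `E*`
  -- satisfies `Γ_k ≅ (M.ext X).gal ≅ Γ_{E*}`, whence `k^× ≃* (E*)^×` and `range id = ⊤ ≃* (E*)^×`.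
  have key : ∀ X : M.Curve, M.IsCor110Input X →
      Nonempty ((MonoidHom.id (((sel (M.ext X).gal).2 : Type)ˣ)).range ≃* (M.base X)ˣ) := by
    intro X hX
    obtain ⟨e₀⟩ := nonempty_continuousMulEquiv_of_iso (M.galIso X)
    obtain ⟨p, hp, E, hfin, ⟨e₁⟩⟩ := IsMLF.exists_galEquiv_padicSubfield (k := M.base X) hX
    have hQX : ∃ b, Q (M.ext X).gal b := ⟨⟨⟨p, hp.out⟩, E⟩, hfin, ⟨e₀.trans e₁⟩⟩
    obtain ⟨hfin', ⟨e₂⟩⟩ := Classical.epsilon_spec hQX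
    haveI : FiniteDimensional ℚ_[((sel (M.ext X).gal).1 : ℕ)] (sel (M.ext X).gal).2 := hfin'
    obtain ⟨u⟩ := nonempty_unitsMulEquiv_of_isMLF_of_padicSubfield (M.base X) hX
      (sel (M.ext X).gal).2 (e₀.symm.trans e₂)
    have hr : (MonoidHom.id (((sel (M.ext X).gal).2 : Type)ˣ)).range = ⊤ :=
      MonoidHom.range_eq_top.mpr fun x => ⟨x, rfl⟩
    exact ⟨(MulEquiv.subgroupCongr hr).trans (Subgroup.topEquiv.trans u.symm)⟩
  -- THE WITNESS ALGORITHM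
  refine ⟨{ obj := fun E =>
              { galCyclotome := PUnit
                arithCyclotome := PUnit
                cycloSync := AddEquiv.refl PUnit
                frobQuot := { (1 : E.gal →* completion (GrpCat.of (Multiplicative ℤ))) with
                  continuous_toFun := continuous_const }
                H1 := ((sel E.gal).2 : Type)ˣ
                baseField := ((sel E.gal).2 : Type)
                kummerBase := MonoidHom.id _
                kummerBase_injective := fun _ _ h => h
                functionField := ℂ
                instAlgebra := (emb (sel E.gal)).toAlgebra
                closedPointDecomp := ∅ }
            map := fun {E F} e =>
              ⟨castEq (hsel (AbsTopI.isoGal e)), RingEquiv.refl ℂ, fun c =>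
                (hcast (hsel (AbsTopI.isoGal e)) c).symm⟩
            map_id := fun _ => rfl
            map_comp := fun _ _ => RingEquiv.ext fun _ => rfl
            comap := fun _ _ => RingHom.id ℂ
            comap_map := fun _ _ _ => rfl }, fun X hX => key X hX⟩

end AbsTopIII

end Literature.AnabelianGeometry.AbsoluteAnabelian

end
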